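import Mathlib
import HarnessLib

/-!
# The six-vertex model on `ℤ²` and the Gaussian-free-field limit of its height function for
# `Δ ∈ [-1, -1/2]` (Duminil-Copin–Kozlowski–Lammers–Manolescu 2026, Thm. 2.8)

H. Duminil-Copin, K. K. Kozlowski, P. Lammers, I. Manolescu, *Gaussian free field convergence of
the six-vertex model with `-1 ≤ Δ ≤ -1/2`*, arXiv:2603.06268 (March 2026) [DKLM2026SixVertexGFF],
read in the held source text (`paper:arxiv-2603.06268`, §2 "Statement of our main result"):

> **Definition 2.1** (six-vertex model on the torus `𝕋_{M,L} = (ℤ/M) × (ℤ/L)`): arrow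
> configurations = orientations of the edges; weight
> `W(ω) = 𝟙{ice rule} · a₁^{n₁} a₂^{n₂} b₁^{n₃} b₂^{n₄} c₁^{n₅} c₂^{n₆}` (`nᵢ` = number of vertices of
> type `i`), specialised to `a₁ = a₂ = a`, `b₁ = b₂ = b`, `c₁ = c₂ = c`; Gibbs measure
> `ℙ_{𝕋_{M,L}} = W / Z`; `Δ = (a² + b² − c²)/(2ab)`. A configuration is *balanced* if on every
> vertical column of horizontal arrows the numbers of left- and right-arrows agree; `L` even.
> **Theorem 2.2** (infinite volume, `a = b = 1`, `c ∈ [1,2]`): the weak limit `ℙ_{ℤ²}` of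
> `ℙ_{𝕋_{M,L}}[ · | balanced]`, first `M → ∞` then `L → ∞`, exists ("the six-vertex measure in
> the plane with slope zero"): `lim_L lim_M ℙ_{𝕋_{M,L}}[A | balanced] = ℙ_{ℤ²}[A]` for every event
> `A` measurable in terms of finitely many edges.
> **§2.2**: height functions `h : F(ℤ²) → ℤ` on faces, `±1` across edges, the face on the LEFT of
> each arrow one unit higher than the face on its right, considered up to additive constants;
> `h(x, y) := h(face with bottom-left corner (⌊x⌋, ⌊y⌋))`, `h^{(δ)}(u) := h(u/δ)`;
> **Def. 2.4**: `Φ_k(u) := 𝔼_{ℤ²}[∏ᵢ (h(uᵢ') − h(uᵢ))]`, `Φ_k^{(δ)}(u) := Φ_k(u/δ)`;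
> **Def. 2.6**: `G_{ℝ²}(x,y) = −(1/2π) log|y − x|`,
> `Ψ_k^{GFF}(u) = ∑_{a, π} (−1)^{ε(a)} ∏_{ij ∈ π} G(aᵢ, aⱼ)` (`aᵢ ∈ {uᵢ, uᵢ'}`, `ε(a)` = parity of the
> number of unprimed choices, `π` over pairings of `{1,…,k}`), on
> `𝒟_k = {u : {uᵢ,uᵢ'} ∩ {uⱼ,uⱼ'} = ∅ for i ≠ j}`;
> **Def. 2.7** (GFF convergence, "the scaling limit of `h` is `σΓ`" iff ALL of): (1) for every
> `k ≥ 1`, `Φ_k^{(δ)} → σ^k Ψ_k^{GFF}` uniformly on compact subsets of `𝒟_k`; (2) for finite-Dirichlet-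
> energy generalised test functions `φ₁,…,φ_n` (compactly supported finite signed measures of total
> mass `0`), the law of `(⟨h^{(δ)}, φᵢ⟩)ᵢ` converges weakly to `𝒩(0, σ²Σ(φ))`,
> `Σᵢⱼ = ∬ G dφᵢ dφⱼ`; (3) convergence in law in `𝒞^α(U)`, `α ∈ (−1,0)` (and Besov/Sobolev).
> **Theorem 2.8.** *The scaling limit of the six-vertex model's height function on `ℤ²` with
> `a = b = 1` and `√3 ≤ c ≤ 2` is `σ · GFF`, where `σ² = 2 / arccos Δ = 1 / arcsin (c/2)`.*

(`c = √3 ⇔ Δ = −1/2`, `σ² = 3/π`: the Baxter–Kelland–Wu point of critical bond percolation on `ℤ²`.)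

## What this file provides

Mathlib and the tree have no six-vertex model, no height functions and no Gaussian free field
(`lean search`: `sixVertex|iceRule|heightFunction|GaussianFreeField|GFF` — nothing outside route
prose). Everything below is a definition with a body, except the one named fact at the end.

* **Configurations and weights** (Def. 2.1), on any product `G₁ × G₂` of additive groups with `1`
  (`ℤ × ℤ` for the plane, `ZMod M × ZMod L` for the torus): `Config V = V → Bool × Bool` records
  for each vertex `v` the orientation of its east edge `v → v + e₁` (`true` = eastward) and of its
  north edge `v → v + e₂` (`true` = northward); `inDegree`, `vertexWeight a b c ω v` (`0` unless
  the ice rule holds; then `a` for types 1–2, `b` for types 3–4 — horizontal arrows parallel — and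
  `c` for types 5–6 — horizontal arrows opposite), `torusWeight`, `IsBalanced`,
  `torusCondProb a b c A = ℙ_{𝕋}[A ∩ balanced] / ℙ_{𝕋}[balanced]` (a ratio of finite sums).
* **The planar slope-zero measure as a predicate** (Thm. 2.2 turned into a definition, so that no
  existence statement is needed to *state* Thm. 2.8): `IsPlanarSixVertexMeasure a b c P` — `P` is a
  probability measure on `Config (ℤ × ℤ)` whose value on every window event
  `{ω | planeWindow n ω ∈ S}` is the iterated limit `lim_{ℓ} lim_{M} ℙ_{𝕋_{M,2ℓ}}[· | balanced]` of
  the corresponding torus window events (`torusCondProbNat`).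
* **Height function** (§2.2, Def. 2.3): `heightAt ω : ℤ × ℤ → ℤ`, the height of the face with
  bottom-left corner `(i, j)` relative to the face at the origin, summed along the path
  "east/west along the bottom row, then north/south" with the printed rule (crossing a north-
  pointing arrow eastwards lowers the height by `1`, crossing an east-pointing arrow northwards
  raises it by `1`); differences `heightAt ω f' − heightAt ω f` are the printed `h(f') − h(f)` for
  ice-rule configurations (path-independence is a property of ice configurations, not needed to
  state anything); `heightPlane ω z = h(⌊re z⌋, ⌊im z⌋)`, `heightScaled ω δ z = h(z/δ)` (`ℝ² = ℂ`).
* **Correlation functions** (Def. 2.4, 2.6): `kPoint P k u`, `kPointScaled P k δ u`, the Green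
  function `greenPlane`, fixed-point-free involutions `fpfInvolutions k` (= pairings of `Fin k`),
  `gffKPoint k u = Ψ_k^{GFF}(u)`, the domain `pairDomain k = 𝒟_k`.
* **Test-function pairing** (Def. 2.5, restricted to continuous compactly supported densities of
  zero mean): `testPairing ω δ ρ = ∫ h^{(δ)} ρ dλ`, `dirichletEnergy ρ = ∬ G ρ ⊗ ρ`.
* `dklmSigma c = (1 / arcsin (c/2))^{1/2}`.
* **Named fact** `DKLM2026_sixVertex_heightFunction_GFF` — Theorem 2.8 in modes (1) and (2) of
  Def. 2.7 (see "Faithfulness" for exactly what is kept).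

## Faithfulness notes

* Vendored: for `a = b = 1`, `√3 ≤ c ≤ 2` and every `P` with `IsPlanarSixVertexMeasure 1 1 c P`,
  **(1)** `Φ_k^{(δ)} → σ^k Ψ_k^{GFF}` uniformly on compact subsets of `𝒟_k` as `δ → 0⁺`, for every
  `k ≥ 1`; **(2)** for every continuous compactly supported `ρ : ℂ → ℝ` with `∫ ρ = 0`, the law of
  `⟨h^{(δ)}, ρ⟩` converges weakly (tested against bounded continuous `g : ℝ → ℝ`) to the centred
  Gaussian of variance `σ² · ∬ G ρ ⊗ ρ` (Mathlib `gaussianReal`). Printed mode (2) is for finite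
  families of finite-Dirichlet-energy signed measures; continuous compactly supported zero-mean
  densities are such test functions, and by linearity of `ρ ↦ ⟨h^{(δ)}, ρ⟩` and Cramér–Wold the
  one-test-function statement over this linear class is equivalent to the finite-family statement
  over the same class — so (2) here is the printed (2) restricted to a sub-class. **Mode (3)**
  (negative-regularity Hölder / Besov / Sobolev convergence in law) is NOT vendored (no such
  function-space carriers here); the vendored statement is therefore weaker than Thm. 2.8, never
  stronger. The anisotropic extension (Thm. 2.9, isoradial embedding) is not vendored either.
* `Real.log 0 = 0` and `x / 0 = 0` make all definitions total; on `𝒟_k` and for `δ > 0` no junk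
  value is met. `Real.toNNReal` guards the (nonnegative) variance.
* The planar measure enters through the predicate; Thm. 2.2 (existence and `Aut(ℤ²)`-invariance of
  `ℙ_{ℤ²}` for `c ∈ [1,2]`) is not restated as a fact here.

## References

* H. Duminil-Copin, K. K. Kozlowski, P. Lammers, I. Manolescu, *Gaussian free field convergence of
  the six-vertex model with `-1 ≤ Δ ≤ -1/2`*, arXiv:2603.06268 (2026): Def. 2.1–2.7, Thm. 2.2,
  Thm. 2.8. [DKLM2026SixVertexGFF]
* N. Berestycki, E. Powell, *Gaussian free field and Liouville quantum gravity* (2025), Ch. 1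
  (GFF as a Gaussian process indexed by test functions).
-/

noncomputable section

open MeasureTheory Filter Topology ProbabilityTheory
open scoped NNReal BoundedContinuousFunction

namespace Literature.Probability.LatticeModels.SixVertex

/-! ### Arrow configurations, ice rule and Boltzmann weights (Def. 2.1) -/

/-- An **arrow configuration** on a square-lattice-like vertex set `V` (`ℤ × ℤ`, or a torus
`ZMod M × ZMod L`): for each vertex `v`, the orientation of its *east* edge `v — v + e₁`
(`(ω v).1 = true` iff it points east, away from `v`) and of its *north* edge `v — v + e₂`
(`(ω v).2 = true` iff it points north). [cite: DKLM2026SixVertexGFF, §2.1] -/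
abbrev Config (V : Type*) : Type _ := V → Bool × Bool

section Local

variable {G₁ G₂ : Type*} [AddGroup G₁] [AddGroup G₂] [One G₁] [One G₂]

/-- The number of arrows pointing INTO the vertex `v = (x, y)`: the east edge contributes iff it
points west, the west edge `(x-1,y) — v` iff it points east, the north edge iff it points south,
the south edge `(x,y-1) — v` iff it points north. [cite: DKLM2026SixVertexGFF, §2.1] -/
def inDegree (ω : Config (G₁ × G₂)) (v : G₁ × G₂) : ℕ :=
  (if (ω v).1 then 0 else 1) + (if (ω (v.1 - 1, v.2)).1 then 1 else 0) +
    (if (ω v).2 then 0 else 1) + (if (ω (v.1, v.2 - 1)).2 then 1 else 0)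

/-- The **ice rule** at `v`: exactly two incoming (hence two outgoing) arrows.
[cite: DKLM2026SixVertexGFF, §2.1] -/
def IceRuleAt (ω : Config (G₁ × G₂)) (v : G₁ × G₂) : Prop :=
  inDegree ω v = 2

/-- The **local Boltzmann weight** at `v` with symmetric weights `a₁ = a₂ = a`, `b₁ = b₂ = b`,
`c₁ = c₂ = c` (Def. 2.1 and Fig. 1): `0` if the ice rule fails at `v`; otherwise, if the two
horizontal arrows at `v` are parallel (then so are the vertical ones), `a` when east/north
orientations agree (types 1, 2: `→→↑↑`, `←←↓↓`) and `b` when they disagree (types 3, 4: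
`→→↓↓`, `←←↑↑`); and `c` when the horizontal arrows point in opposite directions (types 5, 6).
[cite: DKLM2026SixVertexGFF, Def. 2.1] -/
def vertexWeight (a b c : ℝ) (ω : Config (G₁ × G₂)) (v : G₁ × G₂) : ℝ :=
  if inDegree ω v = 2 then
    (if (ω (v.1 - 1, v.2)).1 = (ω v).1 then (if (ω v).1 = (ω v).2 then a else b) else c)
  else 0

end Local

/-! ### The torus Gibbs measure conditioned on balanced configurations (Def. 2.1) -/

section Torus

variable {G₁ G₂ : Type*} [AddGroup G₁] [AddGroup G₂] [One G₁] [One G₂]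
  [Fintype G₁] [Fintype G₂] [DecidableEq G₁] [DecidableEq G₂]

/-- The weight `W(ω) = 𝟙{ice rule} a^{n₁+n₂} b^{n₃+n₄} c^{n₅+n₆}` of a configuration on the finite
torus `G₁ × G₂`, as the product of the local weights. [cite: DKLM2026SixVertexGFF, Def. 2.1] -/
def torusWeight (a b c : ℝ) (ω : Config (G₁ × G₂)) : ℝ :=
  ∏ v : G₁ × G₂, vertexWeight a b c ω v

/-- A configuration is **balanced**: on every vertical column `{x} × G₂` of horizontal (east)
edges, as many arrows point east as west. [cite: DKLM2026SixVertexGFF, §2.1] -/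
def IsBalanced (ω : Config (G₁ × G₂)) : Prop :=
  ∀ x : G₁, 2 * (Finset.univ.filter fun y : G₂ => (ω (x, y)).1 = true).card = Fintype.card G₂

open scoped Classical in
/-- `ℙ_{𝕋}[A | balanced] = (∑_{ω balanced, ω ∈ A} W(ω)) / (∑_{ω balanced} W(ω))` for the torus
Gibbs measure `ℙ_{𝕋} = W / Z` (Def. 2.1); junk `0` if no balanced configuration has positive
weight. [cite: DKLM2026SixVertexGFF, Def. 2.1 and Thm. 2.2] -/
def torusCondProb (a b c : ℝ) (A : Set (Config (G₁ × G₂))) : ℝ :=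
  (∑ ω ∈ Finset.univ.filter (fun ω : Config (G₁ × G₂) => IsBalanced ω ∧ ω ∈ A),
      torusWeight a b c ω) /
    ∑ ω ∈ Finset.univ.filter (fun ω : Config (G₁ × G₂) => IsBalanced ω), torusWeight a b c ω

end Torus

/-! ### Window events and the planar slope-zero measure (Thm. 2.2 as a predicate) -/

/-- The pattern of a planar configuration on the window `[-n, n]²`: the orientations of the east
and north edges of the vertices `(i - n, j - n)`, `0 ≤ i, j ≤ 2n`. Every event depending on
finitely many edges is `{ω | planeWindow n ω ∈ S}` for some `n`, `S`. [folklore] -/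
def planeWindow (n : ℕ) (ω : Config (ℤ × ℤ)) : Config (Fin (2 * n + 1) × Fin (2 * n + 1)) :=
  fun p => ω ((p.1 : ℤ) - n, (p.2 : ℤ) - n)

/-- The same window pattern read on the torus `ZMod M × ZMod L` (integer coordinates reduced
modulo `M`, `L`; faithful as soon as `M, L > 2n + 1`). [folklore] -/
def torusWindow {M L : ℕ} (n : ℕ) (ω : Config (ZMod M × ZMod L)) :
    Config (Fin (2 * n + 1) × Fin (2 * n + 1)) :=
  fun p => ω ((((p.1 : ℤ) - n : ℤ) : ZMod M), (((p.2 : ℤ) - n : ℤ) : ZMod L))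

/-- `ℙ_{𝕋_{M,L}}[window pattern ∈ S | balanced]` as a function of natural numbers `M, L`
(junk `0` for `M = 0` or `L = 0`, where `ZMod 0 = ℤ` is not a finite torus).
[cite: DKLM2026SixVertexGFF, Def. 2.1 and Thm. 2.2] -/
def torusCondProbNat (a b c : ℝ) (M L n : ℕ)
    (S : Set (Config (Fin (2 * n + 1) × Fin (2 * n + 1)))) : ℝ :=
  if hM : M = 0 then 0 else if hL : L = 0 then 0 else
    haveI : NeZero M := ⟨hM⟩
    haveI : NeZero L := ⟨hL⟩
    torusCondProb a b c {ω : Config (ZMod M × ZMod L) | torusWindow n ω ∈ S}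

/-- **`P` is the six-vertex measure in the plane with slope zero** for the weights `a, b, c`
(Theorem 2.2 read as a definition): `P` is a probability measure on planar arrow configurations
(product σ-algebra) such that for every window `n` and every set `S` of window patterns,
`P{planeWindow n ∈ S} = lim_{ℓ → ∞} lim_{M → ∞} ℙ_{𝕋_{M, 2ℓ}}[torusWindow n ∈ S | balanced]`
(iterated limit: the inner limits `q ℓ` exist and converge to the value of `P`; `L = 2ℓ` even as
in the source). Theorem 2.2 asserts that for `a = b = 1`, `c ∈ [1, 2]` such a `P` exists (and is
`Aut(ℤ²)`-invariant); it is unique since window events generate the σ-algebra.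
[cite: DKLM2026SixVertexGFF, Thm. 2.2] -/
def IsPlanarSixVertexMeasure (a b c : ℝ) (P : Measure (Config (ℤ × ℤ))) : Prop :=
  IsProbabilityMeasure P ∧
    ∀ (n : ℕ) (S : Set (Config (Fin (2 * n + 1) × Fin (2 * n + 1)))), ∃ q : ℕ → ℝ,
      (∀ ℓ : ℕ, Tendsto (fun M : ℕ => torusCondProbNat a b c M (2 * ℓ) n S) atTop (𝓝 (q ℓ))) ∧
        Tendsto q atTop (𝓝 (P {ω | planeWindow n ω ∈ S}).toReal)

/-! ### The height function (§2.2, Def. 2.3) -/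

/-- Signed sum over an integer interval: `∑_{a ≤ k < b} f k` if `a ≤ b`, `-∑_{b ≤ k < a} f k`
otherwise (so that `zsumIco f a b + zsumIco f b c = zsumIco f a c`). [folklore] -/
def zsumIco (f : ℤ → ℤ) (a b : ℤ) : ℤ :=
  if a ≤ b then ∑ k ∈ Finset.Ico a b, f k else -∑ k ∈ Finset.Ico b a, f k

/-- Height increment when moving EAST from the face with bottom-left corner `(x, y)` to the face
`(x+1, y)`, across the vertical edge `(x+1, y) — (x+1, y+1)`: `-1` if that arrow points north
(the face on its left, the western one, is the higher), `+1` if it points south.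
[cite: DKLM2026SixVertexGFF, Def. 2.3] -/
def eastStep (ω : Config (ℤ × ℤ)) (x y : ℤ) : ℤ :=
  if (ω (x + 1, y)).2 then -1 else 1

/-- Height increment when moving NORTH from the face `(x, y)` to the face `(x, y+1)`, across the
horizontal edge `(x, y+1) — (x+1, y+1)`: `+1` if that arrow points east (the face on its left, the
northern one, is the higher), `-1` if it points west. [cite: DKLM2026SixVertexGFF, Def. 2.3] -/
def northStep (ω : Config (ℤ × ℤ)) (x y : ℤ) : ℤ :=
  if (ω (x, y + 1)).1 then 1 else -1

/-- The **height function** of a planar configuration at the face with bottom-left corner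
`(i, j)`, normalised by `h(0,0) = 0` (heights are only used through differences, §2.2): sum of the
increments along the path "east/west along the row `0` from `(0,0)` to `(i,0)`, then north/south
along the column `i` to `(i,j)`". For ice-rule configurations this is the printed height function
up to the irrelevant additive constant. [cite: DKLM2026SixVertexGFF, §2.2 and Def. 2.3] -/
def heightAt (ω : Config (ℤ × ℤ)) (f : ℤ × ℤ) : ℤ :=
  zsumIco (fun x => eastStep ω x 0) 0 f.1 + zsumIco (fun y => northStep ω f.1 y) 0 f.2

/-- The piecewise-constant extension `h(x, y) = h(⌊x⌋, ⌊y⌋)` to the plane `ℝ² = ℂ` (§2.2).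
[cite: DKLM2026SixVertexGFF, §2.2] -/
def heightPlane (ω : Config (ℤ × ℤ)) (z : ℂ) : ℤ :=
  heightAt ω (⌊z.re⌋, ⌊z.im⌋)

/-- The scaled height function `h^{(δ)}(u) = h(u/δ)` (§2.2). [cite: DKLM2026SixVertexGFF, §2.2] -/
def heightScaled (ω : Config (ℤ × ℤ)) (δ : ℝ) (z : ℂ) : ℤ :=
  heightPlane ω (z / δ)

/-! ### Multi-point correlation functions of the height function and of the GFF (Def. 2.4, 2.6) -/

/-- The `k`-point correlation function `Φ_k(u) = 𝔼_P[∏ᵢ (h(uᵢ') − h(uᵢ))]` of the height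
function under `P`, for `u = (uᵢ, uᵢ')ᵢ : Fin k → ℂ × ℂ` (Mathlib `∫ … ∂P`; junk `0` if not
integrable). [cite: DKLM2026SixVertexGFF, Def. 2.4] -/
def kPoint (P : Measure (Config (ℤ × ℤ))) (k : ℕ) (u : Fin k → ℂ × ℂ) : ℝ :=
  ∫ ω, ∏ i, ((heightPlane ω (u i).2 : ℝ) - (heightPlane ω (u i).1 : ℝ)) ∂P

/-- The scaled `k`-point function `Φ_k^{(δ)}(u) = Φ_k(u/δ)`. [cite: DKLM2026SixVertexGFF, Def. 2.4] -/
def kPointScaled (P : Measure (Config (ℤ × ℤ))) (k : ℕ) (δ : ℝ) (u : Fin k → ℂ × ℂ) : ℝ :=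
  kPoint P k fun i => ((u i).1 / δ, (u i).2 / δ)

/-- The full-plane Green function `G_{ℝ²}(x, y) = -(1/2π) log |y - x|` (Def. 2.6; `Real.log 0 = 0`
off the intended domain). [cite: DKLM2026SixVertexGFF, §2.3] -/
def greenPlane (x y : ℂ) : ℝ :=
  -(1 / (2 * Real.pi)) * Real.log ‖y - x‖

/-- The fixed-point-free involutions of `Fin k` — in bijection with the **pairings** (partitions
into two-element sets) of `{1, …, k}` used in Def. 2.6 (`i ↦` its partner). [folklore] -/
def fpfInvolutions (k : ℕ) : Finset (Equiv.Perm (Fin k)) :=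
  Finset.univ.filter fun σ => σ * σ = 1 ∧ ∀ i, σ i ≠ i

/-- The point `aᵢ ∈ {uᵢ, uᵢ'}` selected by `a : Fin k → Bool` (`true` = the unprimed `uᵢ`).
[cite: DKLM2026SixVertexGFF, Def. 2.6] -/
def pickPoint {k : ℕ} (u : Fin k → ℂ × ℂ) (a : Fin k → Bool) (i : Fin k) : ℂ :=
  if a i then (u i).1 else (u i).2

/-- The **GFF `k`-point function**
`Ψ_k^{GFF}(u) = ∑_{a} ∑_{π pairing} (-1)^{ε(a)} ∏_{{i,j} ∈ π} G_{ℝ²}(aᵢ, aⱼ)`, `ε(a)` = number of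
indices where the unprimed point is chosen (Def. 2.6 (1); each pair `{i, σ i}` of the involution
`σ` is counted once, through its smaller element). [cite: DKLM2026SixVertexGFF, Def. 2.6] -/
def gffKPoint (k : ℕ) (u : Fin k → ℂ × ℂ) : ℝ :=
  ∑ a : Fin k → Bool, ∑ σ ∈ fpfInvolutions k,
    (-1 : ℝ) ^ (Finset.univ.filter fun i => a i = true).card *
      ∏ i ∈ Finset.univ.filter (fun i : Fin k => i < σ i), greenPlane (pickPoint u a i) (pickPoint u a (σ i))

/-- The domain `𝒟_k = {u : {uᵢ, uᵢ'} ∩ {uⱼ, uⱼ'} = ∅ for i ≠ j}` (Def. 2.6). [cite: DKLM2026SixVertexGFF, Def. 2.6] -/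
def pairDomain (k : ℕ) : Set (Fin k → ℂ × ℂ) :=
  {u | ∀ i j : Fin k, i ≠ j → Disjoint ({(u i).1, (u i).2} : Set ℂ) {(u j).1, (u j).2}}

/-! ### Test functions (Def. 2.5, continuous compactly supported densities) -/

/-- `⟨h^{(δ)}, ρ⟩ = ∫ h(x/δ) ρ(x) dx` for a density `ρ : ℂ → ℝ` (Lebesgue measure on `ℂ = ℝ²`).
[cite: DKLM2026SixVertexGFF, Def. 2.5] -/
def testPairing (ω : Config (ℤ × ℤ)) (δ : ℝ) (ρ : ℂ → ℝ) : ℝ :=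
  ∫ z, (heightScaled ω δ z : ℝ) * ρ z

/-- The Dirichlet energy `∬ G_{ℝ²}(u, v) ρ(u) ρ(v) du dv` of a density (Def. 2.6 (2), `Σ(ρ, ρ)`).
[cite: DKLM2026SixVertexGFF, Def. 2.6] -/
def dirichletEnergy (ρ : ℂ → ℝ) : ℝ :=
  ∫ z, ∫ w, greenPlane z w * ρ z * ρ w

/-- `σ = σ(c) = (1 / arcsin (c/2))^{1/2}`, i.e. `σ² = 2 / arccos Δ = 1 / arcsin (c/2)` for
`a = b = 1`, `Δ = (2 - c²)/2` (Thm. 2.8; `σ² = 3/π` at `c = √3`). [cite: DKLM2026SixVertexGFF, Thm. 2.8] -/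
def dklmSigma (c : ℝ) : ℝ :=
  Real.sqrt (1 / Real.arcsin (c / 2))

/-! ### The named fact -/

/-- **Duminil-Copin–Kozlowski–Lammers–Manolescu 2026, Theorem 2.8** (modes (1)–(2) of Def. 2.7).
*The scaling limit of the six-vertex model's height function on `ℤ²` with `a = b = 1` and
`√3 ≤ c ≤ 2` is `σ · GFF`, `σ² = 2/arccos Δ = 1/arcsin(c/2)`.* Rendered (module docstring): for
every `c ∈ [√3, 2]` and every planar slope-zero six-vertex measure `P` for the weights
`(1, 1, c)` (`IsPlanarSixVertexMeasure`, Thm. 2.2 as a predicate), with `σ = dklmSigma c`: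
**(1)** for every `k ≥ 1` and every compact `K ⊆ 𝒟_k`, the scaled `k`-point functions
`Φ_k^{(δ)}` of the height function converge to `σ^k Ψ_k^{GFF}` uniformly on `K` as `δ → 0⁺`;
**(2)** for every continuous compactly supported `ρ : ℂ → ℝ` with `∫ ρ = 0`, `⟨h^{(δ)}, ρ⟩`
converges in law to the centred Gaussian of variance `σ² ∬ G ρ ⊗ ρ` (weak convergence tested on
bounded continuous functions; Mathlib `gaussianReal`). Mode (3) of Def. 2.7 (Hölder/Besov/Sobolev)
and the finite-family / signed-measure generality of mode (2) are not vendored (the latter is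
equivalent on this sub-class by Cramér–Wold); the vendored statement is a restriction of the
printed one. [cite: DKLM2026SixVertexGFF, Thm. 2.8 with Def. 2.7 (1)–(2)] -/
def DKLM2026_sixVertex_heightFunction_GFF : Prop :=
  ∀ (c : ℝ), Real.sqrt 3 ≤ c → c ≤ 2 →
    ∀ (P : Measure (Config (ℤ × ℤ))), IsPlanarSixVertexMeasure 1 1 c P →
      (∀ (k : ℕ), 1 ≤ k → ∀ K ⊆ pairDomain k, IsCompact K →
          TendstoUniformlyOn (fun δ u => kPointScaled P k δ u)
            (fun u => dklmSigma c ^ k * gffKPoint k u) (𝓝[>] (0 : ℝ)) K) ∧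
        (∀ (ρ : ℂ → ℝ), Continuous ρ → HasCompactSupport ρ → ∫ z, ρ z = 0 →
          ∀ g : ℝ →ᵇ ℝ,
            Tendsto (fun δ => ∫ ω, g (testPairing ω δ ρ) ∂P) (𝓝[>] (0 : ℝ))
              (𝓝 (∫ x, g x ∂(gaussianReal 0 (Real.toNNReal (dklmSigma c ^ 2 * dirichletEnergy ρ))))))

/-! ### API -/

/-- `σ² = 1 / arcsin (c/2)` whenever `arcsin (c/2) ≥ 0`, e.g. for `0 ≤ c`. [cite: DKLM2026SixVertexGFF, Thm. 2.8] -/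
theorem dklmSigma_sq {c : ℝ} (hc : 0 ≤ Real.arcsin (c / 2)) :
    dklmSigma c ^ 2 = 1 / Real.arcsin (c / 2) := by
  rw [dklmSigma, Real.sq_sqrt (one_div_nonneg.mpr hc)]

/-- At the percolation point `c = √3` (`Δ = -1/2`): `σ² = 3/π`. [cite: DKLM2026SixVertexGFF, Thm. 2.8] -/
theorem dklmSigma_sq_sqrt_three : dklmSigma (Real.sqrt 3) ^ 2 = 3 / Real.pi := by
  have h : Real.arcsin (Real.sqrt 3 / 2) = Real.pi / 3 := by
    rw [← Real.sin_pi_div_three]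
    exact Real.arcsin_sin (by linarith [Real.pi_pos]) (by linarith [Real.pi_pos])
  rw [dklmSigma_sq (by rw [h]; positivity), h]
  field_simp

/-- The zero-length signed sum vanishes. [folklore] -/
@[simp] theorem zsumIco_self (f : ℤ → ℤ) (a : ℤ) : zsumIco f a a = 0 := by
  simp [zsumIco]

/-- The height function is normalised at the origin face. [folklore] -/
@[simp] theorem heightAt_zero (ω : Config (ℤ × ℤ)) : heightAt ω (0, 0) = 0 := by
  simp [heightAt]

/-- `eastStep` takes the values `±1`. [folklore] -/
theorem eastStep_eq_or (ω : Config (ℤ × ℤ)) (x y : ℤ) : eastStep ω x y = 1 ∨ eastStep ω x y = -1 := by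
  unfold eastStep
  split_ifs <;> simp

/-- `northStep` takes the values `±1`. [folklore] -/
theorem northStep_eq_or (ω : Config (ℤ × ℤ)) (x y : ℤ) :
    northStep ω x y = 1 ∨ northStep ω x y = -1 := by
  unfold northStep
  split_ifs <;> simp

end Literature.Probability.LatticeModels.SixVertex

end
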